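import Literature.AlgebraicGeometry.Motives.BaseChangeAffineChart
import Literature.AlgebraicGeometry.Resolution.BlowupCharts
import HarnessLib

/-!
# The affine opens `U × V ⊆ X ⊗ Y` of a product of `k`-schemes and their coordinate rings `Γ(U) ⊗ₖ Γ(V)`

Topic `Literature/AlgebraicGeometry/Motives`; theorem-only companion of `BaseChangeAffineChart`
(which treats `U ×_K Spec ℂ`). For `k`-schemes `X, Y : SchemeOver k` (`X ⊗ Y` is Mathlib's
cartesian product in `Over (Spec k)`, whose underlying scheme is `pullback X.hom Y.hom` by `rfl`;
the statements are phrased with `pullback X.hom Y.hom` literally so that instance search and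
rewriting see through them, as in `BaseChangeAffineChart`) and affine opens
`U ⊆ X`, `V ⊆ Y` with coordinate rings `A = Γ(X, U)`, `B = Γ(Y, V)` (as `k`-algebras,
`affineOpenAlgebra`), the open `pr₁⁻¹U ∩ pr₂⁻¹V` of `X ⊗ Y` is the affine scheme `Spec (A ⊗ₖ B)`
(Hartshorne II Thm. 3.3, Steps 3–4 of the proof):

* `exists_tensorChart` — an open immersion `Spec (A ⊗ₖ B) → X ⊗ Y` with range `pr₁⁻¹U ∩ pr₂⁻¹V`,
  compatible with the projections (`a ↦ a ⊗ 1` then `Spec A → X`; `b ↦ 1 ⊗ b` then `Spec B → Y`)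
  (Mathlib `pullbackSpecIso`, `pullback.map`);
* `exists_ringEquiv_tensorAffineOpen` — the affine open `W = pr₁⁻¹U ∩ pr₂⁻¹V` with a ring
  isomorphism `Γ(X ⊗ Y, W) ≅ A ⊗ₖ B` under which `pr₁^* a ↦ a ⊗ 1` and `pr₂^* b ↦ 1 ⊗ b`.

## References

* R. Hartshorne, *Algebraic Geometry* (1977), II §3, Thm. 3.3 (fibre products: the affine case
  `Spec A ×_{Spec R} Spec B = Spec (A ⊗_R B)` and gluing over affine opens). [Hartshorne1977]
-/

noncomputable section

open CategoryTheory CategoryTheory.Limits AlgebraicGeometry TensorProduct MonoidalCategory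

namespace Literature.AlgebraicGeometry.Motives

open Literature.AlgebraicGeometry.Resolution

variable {k : Type} [Field k] (X Y : SchemeOver k) {U : X.left.Opens} (hU : IsAffineOpen U)
  {V : Y.left.Opens} (hV : IsAffineOpen V)

/-- **The chart `Spec (Γ(U) ⊗ₖ Γ(V)) → X ⊗ Y`** over affine opens `U ⊆ X`, `V ⊆ Y`: an open
immersion with range `pr₁⁻¹U ∩ pr₂⁻¹V`, under which the projections become `a ↦ a ⊗ 1` and
`b ↦ 1 ⊗ b` (Hartshorne II Thm. 3.3, proof, Steps 3–4). [cite: Hartshorne1977, II Thm. 3.3] -/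
theorem exists_tensorChart :
    letI := affineOpenAlgebra X hU
    letI := affineOpenAlgebra Y hV
    ∃ (g : Spec (.of (Γ(X.left, U) ⊗[k] Γ(Y.left, V))) ⟶ pullback X.hom Y.hom) (_ : IsOpenImmersion g),
      g ≫ pullback.fst X.hom Y.hom = Spec.map (CommRingCat.ofHom
        (Algebra.TensorProduct.includeLeftRingHom : Γ(X.left, U) →+* Γ(X.left, U) ⊗[k] Γ(Y.left, V))) ≫
          hU.fromSpec ∧
      g ≫ pullback.snd X.hom Y.hom = Spec.map (CommRingCat.ofHom
        (Algebra.TensorProduct.includeRight.toRingHom : Γ(Y.left, V) →+* Γ(X.left, U) ⊗[k] Γ(Y.left, V))) ≫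
          hV.fromSpec ∧
      Set.range g = (pullback.fst X.hom Y.hom) ⁻¹' (U : Set X.left) ∩
        (pullback.snd X.hom Y.hom) ⁻¹' (V : Set Y.left) := by
  letI := affineOpenAlgebra X hU
  letI := affineOpenAlgebra Y hV
  have e₁ : (hU.fromSpec ≫ X.hom) ≫ 𝟙 _ = hU.fromSpec ≫ X.hom := Category.comp_id _
  have e₂ : (hV.fromSpec ≫ Y.hom) ≫ 𝟙 _ = hV.fromSpec ≫ Y.hom := Category.comp_id _
  haveI : IsOpenImmersion (pullback.map (hU.fromSpec ≫ X.hom) (hV.fromSpec ≫ Y.hom) X.hom Y.hom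
      hU.fromSpec hV.fromSpec (𝟙 _) e₁ e₂) := inferInstance
  refine ⟨(pullbackSpecIso k Γ(X.left, U) Γ(Y.left, V)).inv ≫
    (pullback.congrHom (fromSpec_comp_hom_eq X hU) (fromSpec_comp_hom_eq Y hV)).inv ≫
    pullback.map (hU.fromSpec ≫ X.hom) (hV.fromSpec ≫ Y.hom) X.hom Y.hom hU.fromSpec hV.fromSpec
      (𝟙 _) e₁ e₂, inferInstance, ?_, ?_, ?_⟩
  · simp only [Category.assoc]
    rw [pullback.lift_fst, pullback.congrHom_inv, pullback.lift_fst_assoc, Category.comp_id,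
      pullbackSpecIso_inv_fst_assoc]
  · simp only [Category.assoc]
    rw [pullback.lift_snd, pullback.congrHom_inv, pullback.lift_snd_assoc, Category.comp_id,
      pullbackSpecIso_inv_snd_assoc]
    rfl
  · rw [← Scheme.Hom.coe_opensRange, Scheme.Hom.opensRange_comp_of_isIso,
      Scheme.Hom.opensRange_comp_of_isIso, Scheme.Hom.coe_opensRange]
    erw [Scheme.Pullback.range_map]
    rw [hU.range_fromSpec, hV.range_fromSpec]

/-- **The affine open `U × V = pr₁⁻¹U ∩ pr₂⁻¹V ⊆ X ⊗ Y` and its coordinate ring `Γ(U) ⊗ₖ Γ(V)`**: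
a ring isomorphism `Γ(X ⊗ Y, U × V) ≅ Γ(X, U) ⊗ₖ Γ(Y, V)` under which `pr₁^* a ↦ a ⊗ 1` and
`pr₂^* b ↦ 1 ⊗ b`. [cite: Hartshorne1977, II Thm. 3.3] -/
theorem exists_ringEquiv_tensorAffineOpen :
    letI := affineOpenAlgebra X hU
    letI := affineOpenAlgebra Y hV
    ∃ (W : (pullback X.hom Y.hom).Opens) (_ : IsAffineOpen W)
      (hWU : W ≤ pullback.fst X.hom Y.hom ⁻¹ᵁ U) (hWV : W ≤ pullback.snd X.hom Y.hom ⁻¹ᵁ V)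
      (e : Γ(pullback X.hom Y.hom, W) ≃+* Γ(X.left, U) ⊗[k] Γ(Y.left, V)),
      (W : Set ↑(pullback X.hom Y.hom)) = (pullback.fst X.hom Y.hom) ⁻¹' (U : Set X.left) ∩
        (pullback.snd X.hom Y.hom) ⁻¹' (V : Set Y.left) ∧
      (∀ a, e ((pullback.fst X.hom Y.hom).appLE U W hWU a) = a ⊗ₜ 1) ∧
      (∀ b, e ((pullback.snd X.hom Y.hom).appLE V W hWV b) = 1 ⊗ₜ b) := by
  letI := affineOpenAlgebra X hU
  letI := affineOpenAlgebra Y hV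
  obtain ⟨g, hg, hfst, hsnd, hrange⟩ := exists_tensorChart X Y hU hV
  haveI := hg
  have hWU := image_top_le_preimage_of_comp_eq (pullback.fst X.hom Y.hom) g ⟨U, hU⟩ _ hfst
  have hWV := image_top_le_preimage_of_comp_eq (pullback.snd X.hom Y.hom) g ⟨V, hV⟩ _ hsnd
  have kfst := appLE_appIso_ΓSpecIso_of_comp_eq (pullback.fst X.hom Y.hom) g ⟨U, hU⟩ _ hfst hWU
  have ksnd := appLE_appIso_ΓSpecIso_of_comp_eq (pullback.snd X.hom Y.hom) g ⟨V, hV⟩ _ hsnd hWV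
  refine ⟨g ''ᵁ ⊤, ?_, hWU, hWV, (g.appIso ⊤ ≪≫ Scheme.ΓSpecIso _).commRingCatIsoToRingEquiv,
    ?_, fun a ↦ ?_, fun b ↦ ?_⟩
  · rw [Scheme.Hom.image_top_eq_opensRange]; exact isAffineOpen_opensRange g
  · rw [Scheme.Hom.image_top_eq_opensRange, Scheme.Hom.coe_opensRange, hrange]
  · exact congrArg (fun φ : Γ(X.left, U) ⟶ CommRingCat.of (Γ(X.left, U) ⊗[k] Γ(Y.left, V)) ↦
      φ a) kfst
  · exact congrArg (fun φ : Γ(Y.left, V) ⟶ CommRingCat.of (Γ(X.left, U) ⊗[k] Γ(Y.left, V)) ↦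
      φ b) ksnd

end Literature.AlgebraicGeometry.Motives

end
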